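import Summits.ValiantsHypothesis.ValiantsHypothesis.Theorems.SymPencilPerFourPeeledFactor
import Summits.ValiantsHypothesis.ValiantsHypothesis.Theorems.SymPencilPerFourPeeledHessian
import Summits.ValiantsHypothesis.ValiantsHypothesis.Theorems.SymPencilPerFourPeeledFlatRank
import Summits.ValiantsHypothesis.ValiantsHypothesis.Theorems.SymPencilPerFourInnerRankMixedKill

/-!
# Route `SymPencil` — inner rank of the `2 | 2` row split of `per_4`: the PEELED case at `|κ| = 10`
# is impossible when `h = Ψᵀ𝟙` is in generic position (`--supports` stmt-ValiantsHypothesis-5674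
# `SdcSuperquadratic`; (8,8) column, memo `NOTE-p6g16-5674-R2-peeled-ten.md` §§2–3)

**Theorem** (`false_of_peeled_ten_caseA`).  A reduced family (`…InnerRankReducedFamily`) with
`|κ| = 10`, PEELED (non-zero correction), whose scalar `a`-block on the row `𝟙 = (1,1,1,1)` reads
`t((𝟙,0),(e_k,0)) = h_k v₀` with `h₀, h₁, h₂` pairwise distinct and non-zero, does not exist:
`exists_good_t` + `htz_caseA` (Hessian pencil, Case A) feed `factor_of_peeled_ten` (rank-four
factorisation of the flattening of `F' = per − correction`), and `no_rank_four_factor` (F5) refutes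
it, the correction at basis vectors being `X_{ak} Y_{bl}`.  Also `per_basis` : `per(e_a;e_b;e_k;e_l)`
is the indicator of "pairwise distinct".

What is NOT here: the other positions / residual patterns of `h` (memo §2: `S₄`-transport and eight
one-parameter families), `|κ| ≤ 9`, and the pure half (P1).  Honest framing: a conditional step
toward cell (8,8,10); no cell closes; `27 ≤ sdc(per_4) ≤ 29`, the crux and `VP ≠ VNP` untouched.
No definitions, no named facts. [folklore]
-/

noncomputable section

-- single-conjunct layout: Sub = Summit, duplicated namespace component intended
set_option linter.dupNamespace false

namespace Summit.ValiantsHypothesis.ValiantsHypothesis.Theorems.SymPencilPerFourPeeledTenCaseA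

open Matrix Finset Module
open Summit.ValiantsHypothesis.ValiantsHypothesis.Theorems.SymPencilPerFourInnerRankRows
open Summit.ValiantsHypothesis.ValiantsHypothesis.Theorems.SymPencilPerFourInnerRankMixedKill
open Summit.ValiantsHypothesis.ValiantsHypothesis.Theorems.SymPencilPerFourPeeledFactor
open Summit.ValiantsHypothesis.ValiantsHypothesis.Theorems.SymPencilPerFourPeeledHessian
open Summit.ValiantsHypothesis.ValiantsHypothesis.Theorems.SymPencilPerFourPeeledFlatRank

universe u v

variable {K : Type u} [Field K]

/-- `per (e_p; e_p; y; z) = 0` (two equal coordinate rows). [folklore] -/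
theorem per_rep₀₁ (p : Fin 4) (y z : Fin 4 → K) :
    (Matrix.of ![Pi.single p (1 : K), Pi.single p 1, y, z]).permanent = 0 := by
  fin_cases p <;> simp [permanent_of_rows]

/-- **`per (e_a; e_b; e_k; e_l)` is the indicator of "`a, b, k, l` pairwise distinct".**
[folklore] -/
theorem per_basis (a b k l : Fin 4) :
    (Matrix.of ![Pi.single a (1 : K), Pi.single b 1, Pi.single k 1, Pi.single l 1]).permanent =
      if a ≠ b ∧ a ≠ k ∧ a ≠ l ∧ b ≠ k ∧ b ≠ l ∧ k ≠ l then 1 else 0 := by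
  by_cases h : a ≠ b ∧ a ≠ k ∧ a ≠ l ∧ b ≠ k ∧ b ≠ l ∧ k ≠ l
  · rw [if_pos h]
    exact per_single_distinct a b k l h.1 h.2.1 h.2.2.1 h.2.2.2.1 h.2.2.2.2.1 h.2.2.2.2.2
  · rw [if_neg h]
    -- some two rows coincide; move them to the front with the row symmetries of `per`
    have s02 : ∀ u v w x : Fin 4 → K, (Matrix.of ![u, v, w, x]).permanent =
        (Matrix.of ![u, w, v, x]).permanent := fun u v w x => by simp only [permanent_of_rows]; ring
    have s03 : ∀ u v w x : Fin 4 → K, (Matrix.of ![u, v, w, x]).permanent =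
        (Matrix.of ![u, x, w, v]).permanent := fun u v w x => by simp only [permanent_of_rows]; ring
    have s12 : ∀ u v w x : Fin 4 → K, (Matrix.of ![u, v, w, x]).permanent =
        (Matrix.of ![v, w, u, x]).permanent := fun u v w x => by simp only [permanent_of_rows]; ring
    have s13 : ∀ u v w x : Fin 4 → K, (Matrix.of ![u, v, w, x]).permanent =
        (Matrix.of ![v, x, w, u]).permanent := fun u v w x => by simp only [permanent_of_rows]; ring
    have s23 : ∀ u v w x : Fin 4 → K, (Matrix.of ![u, v, w, x]).permanent =
        (Matrix.of ![w, x, u, v]).permanent := fun u v w x => by simp only [permanent_of_rows]; ring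
    simp only [not_and_or, not_ne_iff] at h
    rcases h with h | h | h | h | h | h
    · rw [h]; exact per_rep₀₁ b _ _
    · rw [s02, h]; exact per_rep₀₁ k _ _
    · rw [s03, h]; exact per_rep₀₁ l _ _
    · rw [s12, h]; exact per_rep₀₁ k _ _
    · rw [s13, h]; exact per_rep₀₁ l _ _
    · rw [s23, h]; exact per_rep₀₁ l _ _

/-- **The peeled case at `|κ| = 10` dies from ANY pencil witness**: two parameters `y₀, y₁`
orthogonal to the row-`𝟙` coefficient vector `h`, with `𝐇(y₀) = [per(𝟙;e_b;y₀;e_l)]` invertible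
and the Taussky–Zassenhaus property of `𝐇(y₀)⁻¹𝐇(y₁)`, contradict the flattening-rank lemma F5.
[folklore] -/
theorem false_of_peeled_ten_of_witness [CharZero K] {κ : Type v} [Fintype κ] [DecidableEq κ]
    (hκ : Fintype.card κ = 10) (c : κ → K) (hc : ∀ r, c r ≠ 0)
    (t : κ → (((Fin 4 → K) × (Fin 4 → K)) →ₗ[K] ((Fin 4 → K) × (Fin 4 → K)) →ₗ[K] K))
    (hJ : ∀ a b y₂ y₃ : Fin 4 → K,
      ∑ r, c r * (t r (a, b) (y₂, y₃)) ^ 2 = (Matrix.of ![a, b, y₂, y₃]).permanent)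
    (v₀ v₀' : κ → K) (hv₀ : ∀ (a x : Fin 4 → K), ∃ s : K, (fun r => t r (a, 0) (x, 0)) = s • v₀)
    (hv₀' : ∀ (b x : Fin 4 → K), ∃ s : K, (fun r => t r (0, b) (0, x)) = s • v₀')
    (hpeel : ∃ a b y z : Fin 4 → K, ∑ r, c r * t r (a, 0) (y, 0) * t r (0, b) (0, z) ≠ 0)
    (h : Fin 4 → K) (hh : ∀ k r, t r ((fun _ => 1), 0) (Pi.single k 1, 0) = h k * v₀ r)
    (y₀ y₁ : Fin 4 → K) (hy₀h : ∑ k, y₀ k * h k = 0) (hy₁h : ∑ k, y₁ k * h k = 0)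
    (hdet : IsUnit (Matrix.of fun b l => (Matrix.of ![(fun _ => (1 : K)), Pi.single b 1, y₀,
      Pi.single l 1]).permanent).det)
    (htz : ∀ A : Matrix (Fin 4) (Fin 4) K, Aᵀ = -A →
      A * ((Matrix.of fun b l => (Matrix.of ![(fun _ => (1 : K)), Pi.single b 1, y₀,
          Pi.single l 1]).permanent)⁻¹ *
        (Matrix.of fun b l => (Matrix.of ![(fun _ => (1 : K)), Pi.single b 1, y₁,
          Pi.single l 1]).permanent)) =
      ((Matrix.of fun b l => (Matrix.of ![(fun _ => (1 : K)), Pi.single b 1, y₀,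
          Pi.single l 1]).permanent)⁻¹ *
        (Matrix.of fun b l => (Matrix.of ![(fun _ => (1 : K)), Pi.single b 1, y₁,
          Pi.single l 1]).permanent))ᵀ * A → A = 0) : False := by
  classical
  set P₀ : Matrix (Fin 4) (Fin 4) K := Matrix.of fun b l => (Matrix.of ![(fun _ => (1 : K)),
    Pi.single b 1, y₀, Pi.single l 1]).permanent with hP₀
  set P₁ : Matrix (Fin 4) (Fin 4) K := Matrix.of fun b l => (Matrix.of ![(fun _ => (1 : K)),
    Pi.single b 1, y₁, Pi.single l 1]).permanent with hP₁
  -- `t((𝟙,0),(y,0)) = (Σ y_k h_k) v₀`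
  have hlin : ∀ (y : Fin 4 → K) r, t r ((fun _ => 1), 0) (y, 0) = (∑ k, y k * h k) * v₀ r := by
    intro y r
    have hy : y = ∑ k, y k • (Pi.single k 1 : Fin 4 → K) := by
      ext j
      simp only [Finset.sum_apply, Pi.smul_apply, Pi.single_apply, smul_eq_mul, mul_ite,
        mul_one, mul_zero]
      rw [Finset.sum_ite_eq]; simp
    have hp : ((y, (0 : Fin 4 → K)) : (Fin 4 → K) × (Fin 4 → K)) =
        ∑ k, y k • ((Pi.single k 1 : Fin 4 → K), (0 : Fin 4 → K)) := by
      rw [Prod.ext_iff, Prod.fst_sum, Prod.snd_sum]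
      constructor
      · simp only [Prod.smul_fst]; exact hy
      · simp only [Prod.smul_snd, smul_zero, Finset.sum_const_zero]
    rw [hp, map_sum, Finset.sum_mul]
    refine Finset.sum_congr rfl fun k _ => ?_
    rw [map_smul, smul_eq_mul, hh k r]; ring
  have hy₀ : ∀ r, t r ((fun _ => 1), 0) (y₀, 0) = 0 := by
    intro r; rw [hlin, hy₀h, zero_mul]
  have hy₁ : ∀ r, t r ((fun _ => 1), 0) (y₁, 0) = 0 := by
    intro r; rw [hlin, hy₁h, zero_mul]
  -- the rank-four factorisation
  have hfac := factor_of_peeled_ten hκ c hc t hJ v₀ v₀' hv₀ hv₀' hpeel _ _ hy₀ hy₁ P₀ P₁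
    (fun b l => by rw [hP₀]; rfl) (fun b l => by rw [hP₁]; rfl) hdet htz
  -- the correction at basis vectors is `X_{ak} Y_{bl}`
  choose S hS using hv₀
  choose S' hS' using hv₀'
  have e1 : ∀ (a x : Fin 4 → K) r, t r (a, 0) (x, 0) = S a x * v₀ r := fun a x r => by
    have := congr_fun (hS a x) r; simpa using this
  have e2 : ∀ (b x : Fin 4 → K) r, t r (0, b) (0, x) = S' b x * v₀' r := fun b x r => by
    have := congr_fun (hS' b x) r; simpa using this
  have corr : ∀ a b k l : Fin 4 → K, ∑ r, c r * t r (a, 0) (k, 0) * t r (0, b) (0, l) =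
      S a k * S' b l * ∑ r, c r * v₀ r * v₀' r := by
    intro a b k l
    rw [Finset.mul_sum]
    exact Finset.sum_congr rfl fun r _ => by rw [e1, e2]; ring
  refine no_rank_four_factor
    (fun a k => 2 * S (Pi.single a 1) (Pi.single k 1) * ∑ r, c r * v₀ r * v₀' r)
    (fun b l => S' (Pi.single b 1) (Pi.single l 1))
    (fun i a l =>
      (Matrix.of ![Pi.single a (1 : K), Pi.single i 1, y₀, Pi.single l 1]).permanent
        - 2 * ∑ r, c r * t r (Pi.single a 1, 0) (y₀, 0) * t r (0, Pi.single i 1) (0, Pi.single l 1))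
    (fun b k i => (P₀⁻¹ *ᵥ fun l =>
        (Matrix.of ![(fun _ => (1 : K)), Pi.single b 1, Pi.single k 1, Pi.single l 1]).permanent
          - 2 * ∑ r, c r * t r ((fun _ => 1), 0) (Pi.single k 1, 0) *
            t r (0, Pi.single b 1) (0, Pi.single l 1)) i) ?_
  intro a b k l
  have hf := hfac (Pi.single a 1) (Pi.single b 1) (Pi.single k 1) (Pi.single l 1)
  rw [per_basis, corr] at hf
  convert hf using 1
  ring

/-- **The peeled case at `|κ| = 10`, `h` in Case-A position, is impossible.** [folklore] -/
theorem false_of_peeled_ten_caseA [CharZero K] {κ : Type v} [Fintype κ] [DecidableEq κ]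
    (hκ : Fintype.card κ = 10) (c : κ → K) (hc : ∀ r, c r ≠ 0)
    (t : κ → (((Fin 4 → K) × (Fin 4 → K)) →ₗ[K] ((Fin 4 → K) × (Fin 4 → K)) →ₗ[K] K))
    (hJ : ∀ a b y₂ y₃ : Fin 4 → K,
      ∑ r, c r * (t r (a, b) (y₂, y₃)) ^ 2 = (Matrix.of ![a, b, y₂, y₃]).permanent)
    (v₀ v₀' : κ → K) (hv₀ : ∀ (a x : Fin 4 → K), ∃ s : K, (fun r => t r (a, 0) (x, 0)) = s • v₀)
    (hv₀' : ∀ (b x : Fin 4 → K), ∃ s : K, (fun r => t r (0, b) (0, x)) = s • v₀')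
    (hpeel : ∃ a b y z : Fin 4 → K, ∑ r, c r * t r (a, 0) (y, 0) * t r (0, b) (0, z) ≠ 0)
    (h : Fin 4 → K) (hh : ∀ k r, t r ((fun _ => 1), 0) (Pi.single k 1, 0) = h k * v₀ r)
    (h0 : h 0 ≠ 0) (h1 : h 1 ≠ 0) (h2 : h 2 ≠ 0)
    (h01 : h 0 ≠ h 1) (h02 : h 0 ≠ h 2) (h12 : h 1 ≠ h 2) : False := by
  classical
  -- a good parameter `t₀`
  obtain ⟨t₀, ht0, htα, htβ, -⟩ :=
    exists_good_t (K := K) (-(h 1 / h 2)) (-((h 1 - h 0) / (h 2 - h 0)))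
  have h20 : h 2 - h 0 ≠ 0 := sub_ne_zero.2 h02.symm
  have ht1 : h 1 + t₀ * h 2 ≠ 0 := by
    intro e; apply htα
    field_simp
    linear_combination e
  have ht2 : (h 1 - h 0) + t₀ * (h 2 - h 0) ≠ 0 := by
    intro e; apply htβ
    field_simp
    linear_combination e
  -- the witnesses of Case A
  obtain ⟨hy₀h, hy₁h, hdet, htz⟩ := htz_caseA h t₀ h0 h1 h2 h01 h02 h12 ht0 ht1 ht2
    (Matrix.of fun b l => (Matrix.of ![(fun _ => (1 : K)), Pi.single b 1,
      ![h 1 + t₀ * h 2, -h 0, -(t₀ * h 0), 0], Pi.single l 1]).permanent)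
    (Matrix.of fun b l => (Matrix.of ![(fun _ => (1 : K)), Pi.single b 1,
      ![h 2, 0, -h 0, 0], Pi.single l 1]).permanent)
    (fun b l => rfl) (fun b l => rfl)
  exact false_of_peeled_ten_of_witness hκ c hc t hJ v₀ v₀' hv₀ hv₀' hpeel h hh _ _ hy₀h hy₁h
    hdet htz

end Summit.ValiantsHypothesis.ValiantsHypothesis.Theorems.SymPencilPerFourPeeledTenCaseA

end
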